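import Summits.HubbardSuperconductivity.HubbardSuperconductivity.Theorems.AnisotropyChordTransferFibre3FinXDCheck

/-!
# Route `AnisotropyChord` / H0 rotor rung: FIN per-`L` row-D (KT-2a″) SUB-CELL facts, `L = 10` (42–47)

Row-D facts `xdCellAny0 10 (49/50) la lb aD = true` on quarter sub-cells of the combined cells whose side condition needs `aD ≈ .04` (mechhunt STATUS p3 g7 REPORT 3).
Prover seat `hubbard-h0-rotor-p3` g7; helper for piece A = stmt-HubbardSuperconductivity-23918 of rung 19089 (`--supports`, helper class).
WHAT THIS IS NOT: nothing here proves superconductivity in the Hubbard model (rotor TARGET as worded stays FALSE, g15 verdict); kernel facts /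
assembly for ONE conditional reduction at one `L`.  No sorry.
-/

set_option linter.dupNamespace false
set_option autoImplicit false

namespace Summit.HubbardSuperconductivity.HubbardSuperconductivity.Theorems.AnisotropyChord.Transfer.Fibre3

namespace FinXD

/-- row-D sub-cell `[17982931058407699, 18093936805681820]` of `L = 10`. [folklore] -/
theorem xd10s_139_2 : xdCellAny0 10 (49/50 : ℚ) 17982931058407699 18093936805681820 (1/25 : ℚ) = true := by decide +kernel

/-- row-D sub-cell `[18093936805681820, 18204942552955941]` of `L = 10`. [folklore] -/
theorem xd10s_139_3 : xdCellAny0 10 (49/50 : ℚ) 18093936805681820 18204942552955941 (1/25 : ℚ) = true := by decide +kernel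

/-- row-D sub-cell `[18204942552955941, 18318723443911915]` of `L = 10`. [folklore] -/
theorem xd10s_140_0 : xdCellAny0 10 (49/50 : ℚ) 18204942552955941 18318723443911915 (1/25 : ℚ) = true := by decide +kernel

/-- row-D sub-cell `[18318723443911915, 18432504334867889]` of `L = 10`. [folklore] -/
theorem xd10s_140_1 : xdCellAny0 10 (49/50 : ℚ) 18318723443911915 18432504334867889 (1/25 : ℚ) = true := by decide +kernel

/-- row-D sub-cell `[18432504334867889, 18546285225823863]` of `L = 10`. [folklore] -/
theorem xd10s_140_2 : xdCellAny0 10 (49/50 : ℚ) 18432504334867889 18546285225823863 (1/25 : ℚ) = true := by decide +kernel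

/-- row-D sub-cell `[18546285225823863, 18660066116779837]` of `L = 10`. [folklore] -/
theorem xd10s_140_3 : xdCellAny0 10 (49/50 : ℚ) 18546285225823863 18660066116779837 (1/25 : ℚ) = true := by decide +kernel

end FinXD

end Summit.HubbardSuperconductivity.HubbardSuperconductivity.Theorems.AnisotropyChord.Transfer.Fibre3
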